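import Summits.KontsevichZagierPeriods.KontsevichZagierPeriods.Theorems.TerasomaMultiplicationGammaHodgeSectorMultiplicationEquivalences
import Summits.KontsevichZagierPeriods.KontsevichZagierPeriods.Theorems.TerasomaMultiplicationGammaHodgeSectorCompiler
import Summits.KontsevichZagierPeriods.KontsevichZagierPeriods.Theorems.TerasomaMultiplicationMultiplicationAccessible
import Summits.KontsevichZagierPeriods.KontsevichZagierPeriods.Theorems.TerasomaMultiplicationBetaCancellationOfAyoubPiCancellation

/-!
# `GammaHodgeSector` (stmt-KontsevichZagierPeriods-3742) after the proof of `MultiplicationAccessible`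

Crux 3 of route `TerasomaMultiplication`, `MultiplicationAccessible` (stmt-12305: Gauss multiplication
as chains of moves, uniformly in `n`), is a THEOREM of the tree since 2026-08-16
(`MultiplicationAccessible_of`, `Theorems/TerasomaMultiplicationMultiplicationAccessible.lean`). Every
landed reduction of crux 5 `GammaHodgeSector` carried it as a hypothesis; this file discharges it, so
that the cone of crux 5 no longer mentions crux 3 (bookkeeping corollaries, all one-liners over landed
theorems; no new mathematics, no new definitions):

* `gammaHodgeSector_of_positiveCancellation_alone` — **crux 5 ⟸ stmt-5621 ALONE**
  (`SelbergAMGM.PositiveCancellation`, torsion killing = cancellation by classes of non-zero value in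
  `P = FormalRep ⧸ relations`): the composition of line `koblitz-ogus-halving`, now hypothesis-free
  but for its single stub; with the `MotivatedMoves` copy;
* `gammaHodgeSector_iff_gapSectorBeyondTwelve` — **given `BetaCancellation` (stmt-13633), crux 5 IS
  its residual `GapSectorBeyondTwelve` (stmt-14858)**; one-way pieces
  `gammaHodgeSector_of_betaCancellation_of_gap`, and through the landed equivalences
  `BetaCancellation ↔ KZ.PiCancellation ↔ AyoubPiCancellation` (stmt-0540) the variants
  `gammaHodgeSector_of_piCancellation_of_gap`, `gammaHodgeSector_of_ayoubPiCancellation_of_gap`;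
* `gapSectorBeyondTwelve_of_positiveCancellation` — stmt-5621 settles the residual 14858 as well;
* `gammaHodgeSector_of_gammaHodgePairs_alone`, `gammaHodgeSector_of_betaLinearSector_alone` — the
  cross-route bridges of the relator compiler (surface sector = `GammaHodgePairs` stmt-3743 /
  `BetaLinearSector` stmt-3897, plus `BetaCancellation`, plus the deep residual) without crux 3.

Net map of the crux after 12305 (kernel-checked here and in the imported files):
`5621 ⟹ 3742`, `3742 ⟹ 14858`, `13633 ∧ 14858 ⟹ 3742`, `3742 ⟹ 3743`.
References: Deligne, LNM 900 §7 (Thm 7.18, Koblitz–Ogus appendix); Das 2000; Kontsevich–Zagier 2001 §1.2.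
-/

noncomputable section

open scoped BigOperators

namespace Summit.KontsevichZagierPeriods.GammaHodgeSectorKO

open Literature.NumberTheory.Transcendental
open Literature.NumberTheory.Transcendental.KZ
open Literature.NumberTheory.Transcendental.BetaSymbol
open Summit.KontsevichZagierPeriods.GammaHodgeSectorNegative
  (Admissible HodgeCondition IsCubeBetaRep IsBallCubeRep DeligneIdentity)
open Summit.KontsevichZagierPeriods.KontsevichZagierPeriods.Theses.TerasomaMultiplication
  (GammaHodgeSector MultiplicationAccessible BetaCancellation GapSectorBeyondTwelve)
open Summit.KontsevichZagierPeriods.KontsevichZagierPeriods.Theses.SelbergAMGM (PositiveCancellation)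
open Summit.KontsevichZagierPeriods.KontsevichZagierPeriods.Theses.MotivatedMoves (GammaHodgePairs)
open Summit.KontsevichZagierPeriods.KontsevichZagierPeriods.Theses.FermatIsogeny (BetaLinearSector)
open Summit.KontsevichZagierPeriods.KontsevichZagierPeriods.Theses.AyoubSpecialisation (AyoubPiCancellation)
open Summit.KontsevichZagierPeriods.TerasomaMultiplication.MultiplicationAccessible (MultiplicationAccessible_of)
open Summit.KontsevichZagierPeriods.KontsevichZagierPeriods.BetaCancellationLine
  (betaCancellation_iff_piCancellation betaCancellation_of_ayoubPiCancellation)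

/-! ## §1 Crux 5 from torsion killing alone -/

/-- **`GammaHodgeSector` ⟸ `PositiveCancellation` (stmt-5621) alone.** The composition of line
`koblitz-ogus-halving` (`gammaHodgeSector_of_selbergPositiveCancellation`) with its former hypothesis
`MultiplicationAccessible` (stmt-12305) discharged by the tree's proof `MultiplicationAccessible_of`.
[cite: Deligne1982HodgeCycles, Thm. 7.18] -/
theorem gammaHodgeSector_of_positiveCancellation_alone (hPC : PositiveCancellation) : GammaHodgeSector :=
  gammaHodgeSector_of_selbergPositiveCancellation hPC MultiplicationAccessible_of

/-- The same for the verbatim copy of the crux in route `MotivatedMoves` (stmt-3742 is shared).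
[cite: Deligne1982HodgeCycles, Thm. 7.18] -/
theorem gammaHodgeSector_of_positiveCancellation_alone' (hPC : PositiveCancellation) :
    Summit.KontsevichZagierPeriods.KontsevichZagierPeriods.Theses.MotivatedMoves.GammaHodgeSector :=
  gammaHodgeSector_of_positiveCancellation_alone hPC

/-! ## §2 Given Beta cancellation, crux 5 is exactly its residual beyond level 12 -/

/-- **`BetaCancellation` (stmt-13633) → (`GammaHodgeSector` ↔ `GapSectorBeyondTwelve` (stmt-14858)).**
Forward: the residual is the crux with one idle hypothesis (`GapSectorBeyondTwelve.of_gammaHodgeSector`).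
Backward: the relator compiler `gammaHodgeFromRelators_proof` fed with `MultiplicationAccessible_of`
(12305, PROVED), `dasGapTwelve_holds` (13215, PROVED) and Euler reflection (3383, PROVED).
[cite: Deligne1982HodgeCycles, Thm. 7.18] -/
theorem gammaHodgeSector_iff_gapSectorBeyondTwelve (hB : BetaCancellation) :
    GammaHodgeSector ↔ GapSectorBeyondTwelve :=
  ⟨Summit.KontsevichZagierPeriods.TerasomaMultiplication.GapSectorBeyondTwelve.of_gammaHodgeSector,
    fun hG => (gammaHodgeSector_iff_of_betaCancellation hB).mpr ⟨MultiplicationAccessible_of, hG⟩⟩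

/-- **Crux 5 from `BetaCancellation` (stmt-13633) and the residual `GapSectorBeyondTwelve`
(stmt-14858)** — package (A) of the route without crux 3. [cite: Deligne1982HodgeCycles, Thm. 7.18] -/
theorem gammaHodgeSector_of_betaCancellation_of_gap (hB : BetaCancellation) (hG : GapSectorBeyondTwelve) :
    GammaHodgeSector :=
  (gammaHodgeSector_iff_gapSectorBeyondTwelve hB).mpr hG

/-- **Crux 5 from `KZ.PiCancellation` and the residual** (`BetaCancellation ↔ KZ.PiCancellation`,
`betaCancellation_iff_piCancellation`). [cite: Deligne1982HodgeCycles, Thm. 7.18] -/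
theorem gammaHodgeSector_of_piCancellation_of_gap (hπ : KZ.PiCancellation) (hG : GapSectorBeyondTwelve) :
    GammaHodgeSector :=
  gammaHodgeSector_of_betaCancellation_of_gap (betaCancellation_iff_piCancellation.mpr hπ) hG

/-- **Crux 5 from route AyoubSpecialisation's crux `AyoubPiCancellation` (stmt-0540) and the
residual** (`betaCancellation_of_ayoubPiCancellation`). [cite: Deligne1982HodgeCycles, Thm. 7.18] -/
theorem gammaHodgeSector_of_ayoubPiCancellation_of_gap (h0540 : AyoubPiCancellation)
    (hG : GapSectorBeyondTwelve) : GammaHodgeSector :=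
  gammaHodgeSector_of_betaCancellation_of_gap (betaCancellation_of_ayoubPiCancellation h0540) hG

/-- **Torsion killing settles the residual too**: `PositiveCancellation → GapSectorBeyondTwelve`
(through crux 5). [cite: Deligne1982HodgeCycles, Thm. 7.18] -/
theorem gapSectorBeyondTwelve_of_positiveCancellation (hPC : PositiveCancellation) : GapSectorBeyondTwelve :=
  Summit.KontsevichZagierPeriods.TerasomaMultiplication.GapSectorBeyondTwelve.of_gammaHodgeSector
    (gammaHodgeSector_of_positiveCancellation_alone hPC)

/-- **The two roads to crux 5 after 12305, in one statement**: it follows from torsion killing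
(stmt-5621) OR from Beta cancellation together with the residual (stmt-13633 ∧ stmt-14858).
[cite: Deligne1982HodgeCycles, Thm. 7.18] -/
theorem gammaHodgeSector_of_either_road
    (h : PositiveCancellation ∨ (BetaCancellation ∧ GapSectorBeyondTwelve)) : GammaHodgeSector :=
  h.elim gammaHodgeSector_of_positiveCancellation_alone
    fun h' => gammaHodgeSector_of_betaCancellation_of_gap h'.1 h'.2

/-! ## §3 The cross-route bridges of the compiler without crux 3 -/

/-- **Crux 5 from its divisor range `GammaHodgePairs` (stmt-3743), `BetaCancellation` (stmt-13633) and
the DEEP RESIDUAL** (the crux verbatim on the data whose Beta symbol lies outside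
`RelSpan ⊔ ⟨symbols of the N + N' = 2 instances⟩`) — `gammaHodgeSector_of_gammaHodgePairs` with
`MultiplicationAccessible` discharged. [cite: Deligne1982HodgeCycles, Thm. 7.18] -/
theorem gammaHodgeSector_of_gammaHodgePairs_alone (hP : GammaHodgePairs) (hB : BetaCancellation)
    (hDeep : ∀ (N N' k : ℕ) (x y : Fin N → ℚ) (x' y' : Fin N' → ℚ) (c : ℝ),
      Admissible x y → Admissible x' y' → HodgeCondition N N' k x y x' y' → IsAlgebraic ℚ c →
      wordSym x y - wordSym x' y' - k • bsym (1 / 2) (1 / 2) ∉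
        RelSpan ⊔ AddSubgroup.closure {v | ∃ (M M' e : ℕ) (a b : Fin M → ℚ) (a' b' : Fin M' → ℚ) (q : ℝ),
          M + M' = 2 ∧ Admissible a b ∧ Admissible a' b' ∧ HodgeCondition M M' e a b a' b' ∧
          IsAlgebraic ℚ q ∧ DeligneIdentity e a b a' b' q ∧
          v = wordSym a b - wordSym a' b' - e • bsym (1 / 2) (1 / 2)} →
      ∀ (r : IntegralRep N) (r' : IntegralRep (2 * k + N')),
        IsCubeBetaRep x y r → IsBallCubeRep k x' y' c r' → r.value = r'.value → Equivalent r r') :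
    GammaHodgeSector :=
  gammaHodgeSector_of_gammaHodgePairs hP MultiplicationAccessible_of hB hDeep

/-- **Crux 5 from the Beta-linear sector `BetaLinearSector` (stmt-3897, route FermatIsogeny),
`BetaCancellation` (stmt-13633) and the residual beyond linear pairs** —
`gammaHodgeSector_of_betaLinearSector` with `MultiplicationAccessible` discharged.
[cite: Deligne1982HodgeCycles, Thm. 7.18] -/
theorem gammaHodgeSector_of_betaLinearSector_alone (hL : BetaLinearSector) (hB : BetaCancellation)
    (hRes : ∀ (N N' k : ℕ) (x y : Fin N → ℚ) (x' y' : Fin N' → ℚ) (c : ℝ),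
      Admissible x y → Admissible x' y' → HodgeCondition N N' k x y x' y' → IsAlgebraic ℚ c →
      wordSym x y - wordSym x' y' - k • bsym (1 / 2) (1 / 2) ∉
        RelSpan ⊔ AddSubgroup.closure {v | ∃ (a b a' b' : ℚ) (q : ℝ),
          0 < a ∧ 0 < b ∧ 0 < a' ∧ 0 < b' ∧ IsAlgebraic ℚ q ∧
          ProbabilityTheory.beta a b = q * ProbabilityTheory.beta a' b' ∧ v = bsym a b - bsym a' b'} →
      ∀ (r : IntegralRep N) (r' : IntegralRep (2 * k + N')),
        IsCubeBetaRep x y r → IsBallCubeRep k x' y' c r' → r.value = r'.value → Equivalent r r') :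
    GammaHodgeSector :=
  gammaHodgeSector_of_betaLinearSector hL MultiplicationAccessible_of hB hRes

/-- **The solved-pairs compiler without crux 3**: for any set `S` of solved Beta-word pairs, under
`BetaCancellation` the crux reduces to its residual beyond `RelSpan ⊔ ⟨S⟩`
(`gammaHodgeSector_of_solvedPairs` with `MultiplicationAccessible` discharged). [folklore] -/
theorem gammaHodgeSector_of_solvedPairs_alone (hB : BetaCancellation)
    (S : Set (Multiset (ℚ × ℚ) × Multiset (ℚ × ℚ)))
    (hS : ∀ p ∈ S, IsConstMultiple (prodClass p.1) (prodClass p.2))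
    (hGap : ∀ (N N' k : ℕ) (x y : Fin N → ℚ) (x' y' : Fin N' → ℚ) (c : ℝ),
      Admissible x y → Admissible x' y' → HodgeCondition N N' k x y x' y' → IsAlgebraic ℚ c →
      wordSym x y - wordSym x' y' - k • bsym (1 / 2) (1 / 2) ∉
        RelSpan ⊔ AddSubgroup.closure ((fun p => msym p.1 - msym p.2) '' S) →
      ∀ (r : IntegralRep N) (r' : IntegralRep (2 * k + N')),
        IsCubeBetaRep x y r → IsBallCubeRep k x' y' c r' → r.value = r'.value → Equivalent r r') :
    GammaHodgeSector :=
  gammaHodgeSector_of_solvedPairs MultiplicationAccessible_of hB S hS hGap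

end Summit.KontsevichZagierPeriods.GammaHodgeSectorKO

end
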